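/-
Copyright (c) 2026 the pub-hodgecm-mathlib formalisation cell (harness21).  Prover seat hodgecm-mathlib-K2E3-p06 (g4), Track B «K2-LIT», engine E3, unit U4 «Keys»; deal (D61)
LINE LEAD of the open leaf (U4f-χ₁-ram-one), design D-I v2, step Z3-b of `K2/K2E3-p06/g4/PAPER-Z3-DepthZeroInert.K2E3-p06-g4.md` §1 «KEY CHARACTER SUM»; 2026-09-04.
KERNEL module: THEOREMS ONLY (no definition, no named fact, no `sorry`, no instance, no notation).  Mathlib-only imports.
-/
import Mathlib.NumberTheory.MulChar.Basic
import Mathlib.Data.Complex.Basic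
import Mathlib.LinearAlgebra.FiniteDimensional.Lemmas
import Mathlib.FieldTheory.Finite.Basic
import HarnessLib

/-!
# K2 ∕ E3 «EllipticInputs», unit U4 «Keys» — (U4f-χ₁-ram-one) step Z3-b: THE CHARACTER SUM `Σ_{t ∈ 𝔽_q} ψ(t + δ) = −1` FOR A NON-TRIVIAL MULTIPLICATIVE CHARACTER OF A QUADRATIC
# EXTENSION `𝔽_{q²} ⊃ 𝔽_q` TRIVIAL ON `𝔽_qˣ`   [IrelandRosen1990 Ch. 8 §1; LidlNiederreiter1997 Thm 5.4; Keys1984 §4]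

Cell hodgecm-mathlib (D-0151), FLOOR 0, Track B «K2-LIT», engine E3, crux item H413 = stmt-HodgeConjecture-24833 (route `HCCMUnconditional`, no route verbs); target BY NAME
the OPEN leaf `…K2E3EllipticInputs.U4Keys.sig_K2E3KeysThmTwoContractingRamifiedCharOne` (U4Keys ED. 7), design D-I v2, plan step Z3 (the Casselman pair at depth zero).  Author
K2E3-p06 (g4), line lead (D61).  `--supports stmt-HodgeConjecture-24833 --as helper`; THEOREMS ONLY.  NOT THE PAYER.

THE POINT (PAPER-Z3 §1).  At an inert place the shell integrals of the two cell functionals `Λ_1 f₁`, `Λ_{w₀} f_w` reduce to ONE finite-field fact: for the reduction `λ̄` of a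
conductor-one `χ₁` on `𝔽_{q²}ˣ` — non-trivial, but trivial on `𝔽_qˣ` on Branch B — and a generator `δ̄₀ ∉ 𝔽_q`, **`Σ_{t ∈ 𝔽_q} λ̄(t + δ̄₀) = −1`**: the `q + 1` elements
`{t + δ̄₀ : t ∈ 𝔽_q} ∪ {1}` represent the cosets of `𝔽_qˣ` in `𝔽_{q²}ˣ`, on which `λ̄` is a non-trivial character.  This file proves it over Mathlib's `MulChar` for ANY finite fields
`K ⊂ L` with `finrank K L = 2` (no parity, no CM frame): `Σ_{w ∈ L} ψ w = 0` (Mathlib `MulChar.sum_eq_zero_of_ne_one`) is regrouped along the bijection `(a, b) ↦ a + bδ`,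
`K × K ≅ L` — the `b = 0` column gives `|Kˣ|`, each `b ≠ 0` column gives `Σ_t ψ(t + δ)` (substitute `a = bt`, `ψ(b) = 1`) — so `(q − 1)(1 + Σ_t ψ(t+δ)) = 0`.
* §1 `exists_unique_coords` (every `w ∈ L` is `a + bδ` uniquely: `1, δ` independent and `finrank = 2`).
* §2 **`sum_mulChar_add_eq_neg_one`** — the statement; §3 `mulChar_sq_eq_one_of_sq_mem` (`ψ(δ)² = 1` when `δ² ∈ K`: the sign `ε₀` of PAPER-Z3).
HONEST LABEL: HC_CM is proved only modulo the 7 printed citations (2 remaining named inputs: hLiu418 = stmt-HodgeConjecture-24832, h413 = stmt-HodgeConjecture-24833)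
until rung 0 closes; count-neutral — a finite-field lemma; nothing printed about U(3) is asserted.

## Mathlib search
`MulChar.sum_eq_zero_of_ne_one` (orthogonality), `LinearIndependent.pair_iff`, `LinearIndependent.span_eq_top_of_card_eq_finrank`, `Submodule.mem_span_pair`, `Fintype.sum_equiv`,
`Fintype.sum_prod_type`, `Finset.sum_ite_eq`; no Mathlib lemma states the coset-representative sum for a quadratic extension (`rg "t \+ δ|add_eq_neg_one" Mathlib/NumberTheory` ∅).

## References
* [IrelandRosen1990] K. Ireland, M. Rosen, *A Classical Introduction to Modern Number Theory*, 2nd ed., GTM 84 (1990), Ch. 8 §1 (orthogonality of multiplicative characters).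
* [LidlNiederreiter1997] R. Lidl, H. Niederreiter, *Finite Fields*, 2nd ed. (1997), Thm. 5.4 (character sums over subgroups and cosets).
* [Keys1984] D. Keys, Compositio Math. 51 (1984), §4 (the finite-field sums behind the rank-one Plancherel measure of `SU(2,1)`).
-/

set_option autoImplicit false
-- the mandated namespace has the single-problem summit's repeated segment (`HodgeConjecture.HodgeConjecture`)
set_option linter.dupNamespace false

namespace Summit.HodgeConjecture.HodgeConjecture.Cruxes.H413.K2E3FiniteFieldQuadraticCharacterSum

variable {K L : Type*} [Field K] [Field L] [Algebra K L] [Fintype K] [Fintype L]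

/-! ## §1 Coordinates `w = a + bδ` in a quadratic extension -/

omit [Fintype K] [Fintype L] in
/-- **`1, δ` is a `K`-basis of `L`** when `finrank K L = 2` and `δ ∉ K`: every `w ∈ L` is `a + b·δ` for a UNIQUE pair `(a, b) ∈ K × K` (linear independence of `![1, δ]` from
`δ ∉ K`; spanning from `card = finrank`, Mathlib `LinearIndependent.span_eq_top_of_card_eq_finrank`). [cite: LidlNiederreiter1997, Thm. 5.4] -/
theorem exists_unique_coords (h2 : Module.finrank K L = 2) (δ : L) (hδ : δ ∉ Set.range (algebraMap K L)) (w : L) :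
    ∃! p : K × K, algebraMap K L p.1 + algebraMap K L p.2 * δ = w := by
  -- linear independence of `![1, δ]`
  have hli : LinearIndependent K ![(1 : L), δ] := by
    refine LinearIndependent.pair_iff.2 fun s t hst => ?_
    by_cases ht : t = 0
    · subst ht
      rw [zero_smul, add_zero, smul_eq_zero] at hst
      exact ⟨hst.resolve_right one_ne_zero, rfl⟩
    · exfalso
      apply hδ
      refine ⟨-(s * t⁻¹), ?_⟩
      have h1 : s • (1 : L) = -(t • δ) := eq_neg_of_add_eq_zero_left hst
      rw [Algebra.smul_def, Algebra.smul_def, mul_one] at h1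
      have ht' : algebraMap K L t ≠ 0 := (map_ne_zero _).2 ht
      rw [map_neg, map_mul, map_inv₀, h1, neg_mul, neg_neg, mul_comm (algebraMap K L t) δ, mul_assoc, mul_inv_cancel₀ ht', mul_one]
  -- spanning
  have hspan : Submodule.span K (Set.range ![(1 : L), δ]) = ⊤ :=
    hli.span_eq_top_of_card_eq_finrank (by rw [Fintype.card_fin, h2])
  have hrange : Set.range ![(1 : L), δ] = {1, δ} := by
    ext x
    simp only [Set.mem_range, Set.mem_insert_iff, Set.mem_singleton_iff]
    constructor
    · rintro ⟨i, rfl⟩; fin_cases i <;> simp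
    · rintro (rfl | rfl)
      · exact ⟨0, rfl⟩
      · exact ⟨1, rfl⟩
  have hmem : w ∈ Submodule.span K ({1, δ} : Set L) := by rw [← hrange, hspan]; exact Submodule.mem_top
  obtain ⟨a, b, hab⟩ := Submodule.mem_span_pair.1 hmem
  refine ⟨(a, b), ?_, ?_⟩
  · change algebraMap K L a + algebraMap K L b * δ = w
    rw [← hab, Algebra.smul_def, Algebra.smul_def, mul_one]
  · rintro ⟨a', b'⟩ hw
    change algebraMap K L a' + algebraMap K L b' * δ = w at hw
    have hab' : algebraMap K L a + algebraMap K L b * δ = w := by rw [← hab, Algebra.smul_def, Algebra.smul_def, mul_one]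
    have heq : (a' - a) • (1 : L) + (b' - b) • δ = 0 := by
      rw [sub_smul, sub_smul, Algebra.smul_def a', Algebra.smul_def a, Algebra.smul_def b', Algebra.smul_def b, mul_one, mul_one]
      linear_combination hw - hab'
    obtain ⟨ha, hb⟩ := (LinearIndependent.pair_iff.1 hli) _ _ heq
    exact Prod.ext (sub_eq_zero.1 ha) (sub_eq_zero.1 hb)

/-! ## §2 The coset-representative sum -/

/-- **`Σ_{t ∈ K} ψ(t + δ) = −1`** for a non-trivial multiplicative character `ψ` of the finite field `L`, trivial on `Kˣ`, `[L : K] = 2`, `δ ∉ K`: regroup Mathlib's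
`Σ_{w ∈ L} ψ(w) = 0` along `w = a + bδ` (§1): the column `b = 0` contributes `|Kˣ| = |K| − 1` (`ψ = 1` on `Kˣ`, `ψ 0 = 0`), each column `b ≠ 0` contributes `Σ_t ψ(t + δ)`
(`a + bδ = b(t + δ)`, `t = a∕b`, `ψ(b) = 1`), whence `(|K| − 1)(1 + Σ_t ψ(t + δ)) = 0` and `|K| − 1 ≠ 0` in `ℂ`. [cite: IrelandRosen1990, Ch. 8 §1] [cite: LidlNiederreiter1997, Thm. 5.4]
[cite: Keys1984, §4] -/
theorem sum_mulChar_add_eq_neg_one (h2 : Module.finrank K L = 2) (ψ : MulChar L ℂ) (hψ : ψ ≠ 1)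
    (hK : ∀ c : K, c ≠ 0 → ψ (algebraMap K L c) = 1) (δ : L) (hδ : δ ∉ Set.range (algebraMap K L)) :
    ∑ t : K, ψ (algebraMap K L t + δ) = -1 := by
  classical
  -- the bijection `(a, b) ↦ a + bδ`
  have hbij : Function.Bijective (fun p : K × K => algebraMap K L p.1 + algebraMap K L p.2 * δ) := by
    refine ⟨fun p p' hpp' => ?_, fun w => ?_⟩
    · obtain ⟨p₀, -, huniq⟩ := exists_unique_coords h2 δ hδ (algebraMap K L p.1 + algebraMap K L p.2 * δ)
      exact (huniq p rfl).trans (huniq p' hpp'.symm).symm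
    · obtain ⟨p, hp, -⟩ := exists_unique_coords h2 δ hδ w
      exact ⟨p, hp⟩
  have htot : ∑ w : L, ψ w = 0 := MulChar.sum_eq_zero_of_ne_one hψ
  rw [← (Equiv.ofBijective _ hbij).sum_comp] at htot
  simp only [Equiv.ofBijective_apply] at htot
  rw [Fintype.sum_prod_type] at htot
  -- `htot : ∑ a, ∑ b, ψ (a + bδ) = 0`; swap to `∑ b, ∑ a`
  rw [Finset.sum_comm] at htot
  -- the column `b = 0`
  have hcol0 : ∑ a : K, ψ (algebraMap K L a + algebraMap K L 0 * δ) = (Fintype.card K : ℂ) - 1 := by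
    simp only [map_zero, zero_mul, add_zero]
    have hval : ∀ a : K, ψ (algebraMap K L a) = if a = 0 then 0 else 1 := by
      intro a
      split_ifs with ha
      · rw [ha, map_zero, ψ.map_zero]
      · exact hK a ha
    simp_rw [hval]
    rw [Finset.sum_ite, Finset.sum_const_zero, zero_add, Finset.sum_const, nsmul_eq_mul, mul_one]
    rw [Finset.filter_ne' Finset.univ (0 : K), Finset.card_erase_of_mem (Finset.mem_univ _), Finset.card_univ, Nat.cast_sub Fintype.card_pos, Nat.cast_one]
  -- the columns `b ≠ 0`
  have hcol : ∀ b : K, b ≠ 0 → ∑ a : K, ψ (algebraMap K L a + algebraMap K L b * δ) = ∑ t : K, ψ (algebraMap K L t + δ) := by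
    intro b hb
    -- reindex `a = b t`
    rw [← Equiv.sum_comp (Equiv.mulLeft₀ b hb)]
    refine Finset.sum_congr rfl fun t _ => ?_
    change ψ (algebraMap K L (b * t) + algebraMap K L b * δ) = ψ (algebraMap K L t + δ)
    rw [map_mul, ← mul_add, map_mul, hK b hb, one_mul]
  -- assemble: `0 = (|K| − 1) + (|K| − 1) · S`
  have hsplit : ∑ b : K, ∑ a : K, ψ (algebraMap K L a + algebraMap K L b * δ) =
      ((Fintype.card K : ℂ) - 1) + ((Fintype.card K : ℂ) - 1) * ∑ t : K, ψ (algebraMap K L t + δ) := by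
    rw [← Finset.add_sum_erase Finset.univ _ (Finset.mem_univ (0 : K)), hcol0]
    congr 1
    rw [Finset.sum_congr rfl fun b hb => hcol b (Finset.ne_of_mem_erase hb), Finset.sum_const, nsmul_eq_mul,
      Finset.card_erase_of_mem (Finset.mem_univ _), Finset.card_univ, Nat.cast_sub Fintype.card_pos, Nat.cast_one]
  rw [hsplit] at htot
  have hq : ((Fintype.card K : ℂ) - 1) ≠ 0 := by
    rw [sub_ne_zero, ne_eq, Nat.cast_eq_one]
    exact (Fintype.one_lt_card).ne'
  have h := htot
  -- `(q − 1)(1 + S) = 0`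
  have h' : ((Fintype.card K : ℂ) - 1) * (1 + ∑ t : K, ψ (algebraMap K L t + δ)) = 0 := by rw [mul_add, mul_one]; exact h
  rcases mul_eq_zero.1 h' with h0 | h0
  · exact absurd h0 hq
  · exact eq_neg_of_add_eq_zero_right h0

/-! ## §3 The sign `ε₀ = ψ(δ) = ±1` when `δ² ∈ K` -/

omit [Fintype K] [Fintype L] in
/-- **`ψ(δ)² = 1` when `δ² ∈ Kˣ`** (`ψ` trivial on `Kˣ`): the sign `ε₀` of PAPER-Z3 (for `δ̄₀ = √d̄`, `q` odd). [cite: IrelandRosen1990, Ch. 8 §1] -/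
theorem mulChar_sq_eq_one_of_sq_mem (ψ : MulChar L ℂ) (hK : ∀ c : K, c ≠ 0 → ψ (algebraMap K L c) = 1) (δ : L)
    {d : K} (hd : d ≠ 0) (hδ : δ * δ = algebraMap K L d) : ψ δ * ψ δ = 1 := by
  rw [← map_mul, hδ, hK d hd]

end Summit.HodgeConjecture.HodgeConjecture.Cruxes.H413.K2E3FiniteFieldQuadraticCharacterSum
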